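import Summits.Ventures.PercRepro.ProfileGapMonoThresholdNullityFourAll

/-!
# PercRepro — THE TOP THRESHOLD OF THE CO-RANK-`q` FAMILY REDUCES TO SIMPLE COLOOP-FREE MATROIDS, AT EVERY
CO-RANK `q ≥ 2` AND EVERY NULLITY BOUND `k` (p5, gen 33; `proofs/P5-GM1.md` §45(e))

The strong induction of `thresholdIneq_four_top_of_nullity_le_four` with `4` replaced by `q` and the nullity bound by
`k`: if the top threshold `(I_{ρ(E)−1})` at co-rank `q` holds on every SIMPLE COLOOP-FREE matroid of nullity `≤ k` and
rank `≥ q + 1`, and the top threshold at co-rank `q − 1` holds on every matroid of nullity `≤ k − 1` and rank `≥ q`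
(the input of the parallel-pair reduction: for `z ∥ z'` the contraction `N ∖ z ／ z'` has rank `ρ(E) − 1` and one
point of nullity fewer), then the co-rank-`q` top threshold holds on every finite matroid of nullity `≤ k` and rank
`≥ q`.  Rank `q` is vacuous (`thresholdIneq_pred_iff`), a loop is deleted at the same threshold, a coloop lowers the
rank and the threshold together, a parallel element is deletion-monotone (`delMonoT_of_parallel`).  At `q = 4` the
co-rank-`3` input is `thresholdIneq_three_all` (every nullity); at `q = 5` it is
`thresholdIneq_four_top_of_nullity_le_four` for `k ≤ 5`.  Nothing open is asserted.

* `rk_gr_delete_contract_add_one` (the rank of `N ∖ z ／ z'` for `z ∥ z'` on a coloop-free matroid),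
  **`thresholdIneq_top_of_simple_coloopFree`**.
-/

open scoped Matroid

namespace PercRepro.Cogirth

open Finset ThmH Skew Shadow Profile

variable {α : Type} [DecidableEq α]

section Contract

variable {N : Matroid α} [N.Finite]

/-- For `z ∥ z'` on a matroid in which `z` is not a coloop, the contraction `N ∖ z ／ z'` has rank `ρ(E) − 1`
and ground set `E ∖ {z, z'}`. -/
theorem rk_gr_delete_contract_add_one {z z' : α} (hz' : z' ∈ gr N) (hzz' : z ≠ z')
    (h1 : rk N {z'} = 1) (hzc : rk N ((gr N).erase z) = rk N (gr N)) :
    rk (N ＼ ({z} : Set α) ／ ({z'} : Set α)) (gr (N ＼ ({z} : Set α) ／ ({z'} : Set α))) + 1 = rk N (gr N) := by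
  have hz'E : z' ∈ (gr N).erase z := mem_erase.2 ⟨Ne.symm hzz', hz'⟩
  have hz'I : (N ＼ ({z} : Set α)).Indep {z'} := by
    have h := indep_of_rk_eq_card (M := N ＼ ({z} : Set α)) (X := {z'})
      (by rw [card_singleton, rk_delete (singleton_subset_iff.2 hz'E)]; exact h1)
    rwa [coe_singleton] at h
  rw [gr_contract', gr_delete']
  have h := rk_contract_add_one hz'I (X := ((gr N).erase z).erase z') (by rw [gr_delete'])
  rw [insert_erase hz'E, rk_delete (Subset.refl _), hzc] at h
  exact h

end Contract

section Reduction

/-- **THE CO-RANK-`q` TOP THRESHOLD REDUCES TO SIMPLE COLOOP-FREE MATROIDS** (`2 ≤ q`, nullity bound `k`): from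
`ThresholdIneq N q (ρ(E) − 1)` on every simple coloop-free `N` with `#E ≤ ρ(E) + k` and `ρ(E) ≥ q + 1`, and
`ThresholdIneq N' (q − 1) (ρ(E') − 1)` on every `N'` with `#E' + 1 ≤ ρ(E') + k` and `ρ(E') ≥ q` (the contractions
`N ∖ z ／ z'` of the parallel pairs), the same on every finite matroid with `#E ≤ ρ(E) + k` and `ρ(E) ≥ q`. -/
theorem thresholdIneq_top_of_simple_coloopFree (q k : ℕ) (hq : 2 ≤ q)
    (hsimple : ∀ (N : Matroid α) [N.Finite], (∀ x ∈ gr N, ∀ y ∈ gr N, x ≠ y → rk N {x, y} = 2) →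
      (∀ z ∈ gr N, rk N ((gr N).erase z) = rk N (gr N)) → (gr N).card ≤ rk N (gr N) + k →
      q + 1 ≤ rk N (gr N) → ThresholdIneq N q (rk N (gr N) - 1))
    (hcontract : ∀ (N' : Matroid α) [N'.Finite], (gr N').card + 1 ≤ rk N' (gr N') + k →
      q ≤ rk N' (gr N') → ThresholdIneq N' (q - 1) (rk N' (gr N') - 1))
    (N : Matroid α) [N.Finite] (hn : (gr N).card ≤ rk N (gr N) + k) (hR : q ≤ rk N (gr N)) :
    ThresholdIneq N q (rk N (gr N) - 1) := by
  suffices H : ∀ n, ∀ (N : Matroid α) [N.Finite], (gr N).card = n →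
      (gr N).card ≤ rk N (gr N) + k → q ≤ rk N (gr N) → ThresholdIneq N q (rk N (gr N) - 1) from
    H _ N rfl hn hR
  intro n
  induction n using Nat.strong_induction_on with
  | _ n ih =>
  intro N _ hn hnu hR
  -- rank exactly `q`: the threshold `q − 1` is the vacuous `(I_q)`
  rcases Nat.lt_or_ge (rk N (gr N)) (q + 1) with hRq | hRq1
  · have hq' : rk N (gr N) = q := by omega
    have h : ThresholdIneq N q q := thresholdIneq_of_rk_le (by omega)
    have h' : ThresholdIneq N q (q - 1) := (thresholdIneq_pred_iff (by omega)).2 h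
    rw [hq']
    exact h'
  -- a loop: deleted at the same threshold, the rank unchanged
  by_cases hloop : ∃ ℓ ∈ gr N, rk N {ℓ} = 0
  · obtain ⟨ℓ, hℓ, h0⟩ := hloop
    have hpos : 0 < (gr N).card := card_pos.2 ⟨ℓ, hℓ⟩
    have hrk : rk (N ＼ ({ℓ} : Set α)) (gr (N ＼ ({ℓ} : Set α))) = rk N (gr N) := by
      rw [gr_delete', rk_delete (Subset.refl _)]
      have h := rk_insert_of_loop hℓ h0 (erase_subset ℓ (gr N))
      rw [insert_erase hℓ] at h
      exact h.symm
    have hcard : (gr (N ＼ ({ℓ} : Set α))).card = (gr N).card - 1 := by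
      rw [gr_delete', card_erase_of_mem hℓ]
    have h := ih _ (by omega) (N ＼ ({ℓ} : Set α)) rfl (by omega) (by omega)
    rw [hrk] at h
    exact thresholdIneq_top_of_loop hℓ h0 h
  push Not at hloop
  have hone : ∀ x ∈ gr N, rk N {x} = 1 := by
    intro x hx
    have hle : rk N {x} ≤ ({x} : Finset α).card := rk_le_card' _
    rw [card_singleton] at hle
    have := hloop x hx
    omega
  -- a coloop: the rank and the threshold drop together
  by_cases hcol : ∃ z ∈ gr N, rk N ((gr N).erase z) + 1 = rk N (gr N)
  · obtain ⟨z, hz, hzc⟩ := hcol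
    have hpos : 0 < (gr N).card := card_pos.2 ⟨z, hz⟩
    have hrk := rk_gr_delete_of_coloop hzc
    have hcard : (gr (N ＼ ({z} : Set α))).card = (gr N).card - 1 := by
      rw [gr_delete', card_erase_of_mem hz]
    exact thresholdIneq_top_of_coloop hz hzc hq (by omega)
      (ih _ (by omega) (N ＼ ({z} : Set α)) rfl (by omega) (by omega))
  push Not at hcol
  have hcf : ∀ z ∈ gr N, rk N ((gr N).erase z) = rk N (gr N) := by
    intro z hz
    have h := hcol z hz
    have := rk_le_rk_erase_add_one (M := N) (Subset.refl _) hz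
    have := rk_mono' (M := N) (erase_subset z (gr N))
    omega
  -- a parallel pair: the parallel-pair reduction with the co-rank-`(q−1)` input on `N ∖ z ／ z'`
  by_cases hpar : ∃ z ∈ gr N, ∃ z' ∈ gr N, z ≠ z' ∧ rk N {z, z'} = 1
  · obtain ⟨z, hz, z', hz', hzz', h1⟩ := hpar
    have hpos : 0 < (gr N).card := card_pos.2 ⟨z, hz⟩
    have hrk'' := rk_gr_delete_contract_add_one hz' hzz' (hone z' hz') (hcf z hz)
    have hcard'' : (gr (N ＼ ({z} : Set α) ／ ({z'} : Set α))).card = (gr N).card - 1 - 1 := by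
      rw [gr_contract', gr_delete', card_erase_of_mem (mem_erase.2 ⟨Ne.symm hzz', hz'⟩),
        card_erase_of_mem hz]
    have hdel : ThresholdIneq (N ＼ ({z} : Set α) ／ ({z'} : Set α)) (q - 1) (rk N (gr N) - 1 - 1) := by
      have h := hcontract (N ＼ ({z} : Set α) ／ ({z'} : Set α)) (by omega) (by omega)
      have : rk N (gr N) - 1 - 1 =
          rk (N ＼ ({z} : Set α) ／ ({z'} : Set α)) (gr (N ＼ ({z} : Set α) ／ ({z'} : Set α))) - 1 := by
        omega
      rw [this]
      exact h
    have hrk : rk (N ＼ ({z} : Set α)) (gr (N ＼ ({z} : Set α))) = rk N (gr N) := by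
      rw [gr_delete', rk_delete (Subset.refl _)]
      exact hcf z hz
    have hcard : (gr (N ＼ ({z} : Set α))).card = (gr N).card - 1 := by
      rw [gr_delete', card_erase_of_mem hz]
    have h := ih _ (by omega) (N ＼ ({z} : Set α)) rfl (by omega) (by omega)
    rw [hrk] at h
    exact thresholdIneq_of_delMonoT
      (delMonoT_of_parallel hz hz' hzz' (hone z hz) (hone z' hz') h1 hq (by omega) hdel) h
  push Not at hpar
  have hpair : ∀ x ∈ gr N, ∀ y ∈ gr N, x ≠ y → rk N {x, y} = 2 := by
    intro x hx y hy hxy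
    have hne1 := hpar x hx y hy hxy
    have hle : rk N {x, y} ≤ ({x, y} : Finset α).card := rk_le_card' _
    rw [card_pair hxy] at hle
    have hmono : rk N {x} ≤ rk N {x, y} := rk_mono' (singleton_subset_iff.2 (mem_insert_self _ _))
    have := hone x hx
    omega
  -- simple, loopless, coloop-free, rank `≥ q + 1`: the hypothesis
  exact hsimple N hpair hcf hnu hRq1

/-- **The nullity-`≤ 4` theorem at co-rank `4` from the general reduction**: the co-rank-`3` input is
`thresholdIneq_three_all`, the simple input the three simple coloop-free theorems. -/
theorem thresholdIneq_four_top_of_nullity_le_four'' (N : Matroid α) [N.Finite]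
    (hn : (gr N).card ≤ rk N (gr N) + 4) (hR : 4 ≤ rk N (gr N)) :
    ThresholdIneq N 4 (rk N (gr N) - 1) := by
  refine thresholdIneq_top_of_simple_coloopFree 4 4 (by norm_num) ?_ ?_ N hn hR
  · intro N _ hpair hcf hnu hR5
    rcases Nat.lt_or_ge (gr N).card (rk N (gr N) + 3) with hnu2 | hnu3
    · exact thresholdIneq_four_top_of_nullity_le_two (by omega)
    rcases Nat.lt_or_ge (gr N).card (rk N (gr N) + 4) with hnu3' | hnu4
    · exact thresholdIneq_four_top_of_nullity_three hcf (by omega) (by omega)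
    · exact thresholdIneq_four_top_of_nullity_four hpair hcf (by omega) hR5
  · intro N' _ _ hR'
    exact thresholdIneq_three_all N' (by omega)

end Reduction

end PercRepro.Cogirth
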